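import Mathlib
import HarnessLib
import Literature.NumberTheory.Sieve.IwaniecAlmostPrimesWeightedSum
import Literature.NumberTheory.Sieve.IwaniecAlmostPrimesProp2Prep
import Literature.NumberTheory.Sieve.PolynomialCongruences

/-!
# Crux `SplitBlockJacobi` (stmt-Parity-11583, route `IsogenyRedei`), line
# `cofactor-root-discrepancy`: the root Weyl sum under CRT (support for `stub_weylShallow`)

Support lemmas for the OPEN stub `stub_weylShallow` (the stub itself is not proved here).
Everything is stated DEF-FREE, i.e. with the bodies of the skeleton's

* `rootWeylSum h q = ∑_{ν mod q, ν² ≡ -1 (q)} e(hν/q)`,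
* `twistedSum h P₁ P₁' P₂ P₂' = Σ_{Q ∈ (P₁,P₁'], Q' ∈ (P₂,P₂'] primes ≡ 1 (4)} (Q|Q')·S(h,QQ')`

pasted in place of the names, so that the lead can use them by `exact`/`simpa [rootWeylSum]`.

Contents:

* `rootWeylSum_mul_of_coprime` (registered sub-goal) — TWISTED MULTIPLICATIVITY (Kloosterman point):
  for coprime `q₁, q₂` and `q₂u₂ ≡ 1 (q₁)`, `q₁u₁ ≡ 1 (q₂)`,
  `S(h, q₁q₂) = S(hu₂, q₁) · S(hu₁, q₂)`.  Proof: the CRT bijection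
  `ν ↦ (ν mod q₁, ν mod q₂)` between roots of `ν² ≡ -1` modulo `q₁q₂` and pairs of roots, with
  `ν ≡ q₂u₂·(ν mod q₁) + q₁u₁·(ν mod q₂) (mod q₁q₂)`, and `e(integer) = 1`.
* `Weyl.norm_rootWeylSum_le_card` / `…_le_rho` — `‖S(h,q)‖ ≤ ρ(q)` (each term has norm one).
* `Weyl.rho_mul_le_four_of_prime` — `ρ(QQ') ≤ 4` for primes `Q, Q'` (tree: `ρ(p) ≤ 2`,
  `ρ(p²) ≤ 2`, multiplicativity).
* `norm_twistedSum_le` (registered sub-goal) — the TRIVIAL BOUND `‖T_h‖ ≤ 4 · #{Q} · #{Q'}`; so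
  `TierWeylBound` is non-trivial exactly when the box has `≳ x^{1-ε₀}` prime pairs.
* `Weyl.exists_root_of_prime_mod_four_eq_one`, `Weyl.card_roots_eq_two_of_prime_mod_four_eq_one`
  — a prime `Q ≡ 1 (mod 4)` has a root of `-1`, and exactly two (`ρ(Q) = 2`).
* `Weyl.rootWeylSum_prime_eq_two_mul_cos` — for an odd prime `Q` and a root `r`,
  `S(a, Q) = 2 cos(2π a r / Q)` (so each CRT factor is a real cosine), and
  `Weyl.rootWeylSum_prime_mul_prime` — `S(h, QQ') = 4 cos(2π h Q̄' r/Q) cos(2π h Q̄ r'/Q')` for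
  distinct odd primes.
* `Weyl.rootWeylSum_eq_polyRootWeylSum` — the bridge `S(h,q) = polyRootWeylSum (X²+1) q h` to the
  tree's Weyl sums over roots of polynomial congruences (Hooley / Duke–Friedlander–Iwaniec 1995 /
  Tóth files `PolynomialCongruences*`, `QuadraticRootsPrimeModuliDFI*`).
-/

/- LOG (stub-worker w-weylShallow):
  proved here: (B) rootWeylSum_mul_of_coprime, (C) norm_twistedSum_le (+ norm_rootWeylSum_le_card,
  rho_mul_le_four_of_prime, exists_root_of_prime_mod_four_eq_one,
  card_roots_eq_two_of_prime_mod_four_eq_one, rootWeylSum_prime_eq_two_mul_cos,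
  rootWeylSum_prime_mul_prime, rootWeylSum_eq_polyRootWeylSum).
  (A) tierWeylBound_of_mixedBilinear is in work/stubs/WeylCorner.lean.
  Landing: first real proposal p83130 BOUNCED (supports.stub-mismatch: a --supports file must prove
  a REGISTERED stub by name+signature); so rootWeylSum_mul_of_coprime and norm_twistedSum_le were
  restated in ∀-form in the parent namespace and registered via
  `ledger workitem stub-add stmt-Parity-11583 --name … --signature @sig.txt` (sigs in logs/).
  stub_weylShallow itself: OPEN (MixedBilinear), not attempted. -/

noncomputable section

open Finset
open Literature.NumberTheory.Sieve.Iwaniec1978 (rho rho_le_two rho_mul_of_coprime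
  rho_primePow_le_two)

namespace Summit.Parity.BatemanHorn.Cruxes.SplitBlockJacobi.CofactorRootDiscrepancy

namespace Weyl

/-! ### CRT: twisted multiplicativity of the root Weyl sum -/

/-- The phase computation behind the CRT factorisation: if
`ν = q₂u₂a₁ + q₁u₁a₂ + q₁q₂k` in `ℤ` then `e(hν/(q₁q₂)) = e(hu₂a₁/q₁) · e(hu₁a₂/q₂)`. [folklore] -/
theorem exp_crt_split {q₁ q₂ : ℕ} (hq₁ : q₁ ≠ 0) (hq₂ : q₂ ≠ 0) (h k : ℤ)
    (ν a₁ a₂ u₁ u₂ : ℕ) (hν : (ν : ℤ) = q₂ * u₂ * a₁ + q₁ * u₁ * a₂ + q₁ * q₂ * k) :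
    Complex.exp (2 * Real.pi * Complex.I * (h : ℂ) * (ν : ℂ) / ((q₁ * q₂ : ℕ) : ℂ)) =
      Complex.exp (2 * Real.pi * Complex.I * ((h * u₂ : ℤ) : ℂ) * (a₁ : ℂ) / (q₁ : ℂ)) *
        Complex.exp (2 * Real.pi * Complex.I * ((h * u₁ : ℤ) : ℂ) * (a₂ : ℂ) / (q₂ : ℂ)) := by
  rw [← Complex.exp_add]
  refine Complex.exp_eq_exp_iff_exists_int.mpr ⟨h * k, ?_⟩
  have hνC : (ν : ℂ) = q₂ * u₂ * a₁ + q₁ * u₁ * a₂ + q₁ * q₂ * k := by exact_mod_cast hν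
  have h1 : (q₁ : ℂ) ≠ 0 := by exact_mod_cast hq₁
  have h2 : (q₂ : ℂ) ≠ 0 := by exact_mod_cast hq₂
  push_cast
  rw [hνC]
  field_simp

/-- A root of `ν² ≡ -1 (mod q₁q₂)` reduces to a root modulo `q₁`. [folklore] -/
theorem dvd_mod_sq_add_one {q d ν : ℕ} (hdq : d ∣ q) (hν : q ∣ ν ^ 2 + 1) :
    d ∣ (ν % d) ^ 2 + 1 :=
  Nat.modEq_zero_iff_dvd.mp ((((Nat.mod_modEq ν d).pow 2).add_right 1).trans
    (Nat.modEq_zero_iff_dvd.mpr (hdq.trans hν)))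

end Weyl

/-- **Twisted multiplicativity of the root Weyl sum** (CRT, the "Kloosterman point" of card
`prime-pair-crt-corner`): for coprime `q₁, q₂` and `q₂u₂ ≡ 1 (mod q₁)`, `q₁u₁ ≡ 1 (mod q₂)`,
`S(h, q₁q₂) = S(hu₂, q₁) · S(hu₁, q₂)` where `S(h,q) = Σ_{ν mod q, ν²≡-1} e(hν/q)` is the
skeleton's `rootWeylSum h q` (stated with its body expanded; registered sub-goal of
stmt-Parity-11583, support for `stub_weylShallow`). [folklore] -/
theorem rootWeylSum_mul_of_coprime :
    ∀ (h : ℤ) {q₁ q₂ : ℕ}, Nat.Coprime q₁ q₂ → ∀ {u₁ u₂ : ℕ}, q₂ * u₂ ≡ 1 [MOD q₁] →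
      q₁ * u₁ ≡ 1 [MOD q₂] →
        ∑ ν ∈ (Finset.range (q₁ * q₂)).filter (fun ν : ℕ => q₁ * q₂ ∣ ν ^ 2 + 1),
            Complex.exp (2 * Real.pi * Complex.I * (h : ℂ) * (ν : ℂ) / ((q₁ * q₂ : ℕ) : ℂ)) =
          (∑ ν ∈ (Finset.range q₁).filter (fun ν : ℕ => q₁ ∣ ν ^ 2 + 1),
              Complex.exp (2 * Real.pi * Complex.I * ((h * u₂ : ℤ) : ℂ) * (ν : ℂ) / (q₁ : ℂ))) *
            ∑ ν ∈ (Finset.range q₂).filter (fun ν : ℕ => q₂ ∣ ν ^ 2 + 1),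
              Complex.exp (2 * Real.pi * Complex.I * ((h * u₁ : ℤ) : ℂ) * (ν : ℂ) / (q₂ : ℂ)) := by
  intro h q₁ q₂ hco u₁ u₂ hu₂ hu₁
  rcases Nat.eq_zero_or_pos q₁ with rfl | hq₁
  · simp
  rcases Nat.eq_zero_or_pos q₂ with rfl | hq₂
  · simp
  rw [Finset.sum_mul_sum, ← Finset.sum_product']
  refine Finset.sum_nbij' (fun ν => (ν % q₁, ν % q₂))
    (fun p => (Nat.chineseRemainder hco p.1 p.2 : ℕ)) ?_ ?_ ?_ ?_ ?_
  · -- maps roots to pairs of roots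
    intro ν hν
    rw [Finset.mem_filter, Finset.mem_range] at hν
    rw [Finset.mem_product, Finset.mem_filter, Finset.mem_filter, Finset.mem_range,
      Finset.mem_range]
    exact ⟨⟨Nat.mod_lt _ hq₁, Weyl.dvd_mod_sq_add_one (dvd_mul_right q₁ q₂) hν.2⟩,
      ⟨Nat.mod_lt _ hq₂, Weyl.dvd_mod_sq_add_one (dvd_mul_left q₂ q₁) hν.2⟩⟩
  · -- the CRT lift of a pair of roots is a root
    rintro ⟨ν₁, ν₂⟩ hp
    rw [Finset.mem_product, Finset.mem_filter, Finset.mem_filter, Finset.mem_range,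
      Finset.mem_range] at hp
    obtain ⟨⟨-, h₁⟩, ⟨-, h₂⟩⟩ := hp
    rw [Finset.mem_filter, Finset.mem_range]
    set c := Nat.chineseRemainder hco ν₁ ν₂
    refine ⟨Nat.chineseRemainder_lt_mul hco ν₁ ν₂ hq₁.ne' hq₂.ne', ?_⟩
    refine hco.mul_dvd_of_dvd_of_dvd ?_ ?_
    · exact Nat.modEq_zero_iff_dvd.mp (((c.2.1.pow 2).add_right 1).trans
        (Nat.modEq_zero_iff_dvd.mpr h₁))
    · exact Nat.modEq_zero_iff_dvd.mp (((c.2.2.pow 2).add_right 1).trans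
        (Nat.modEq_zero_iff_dvd.mpr h₂))
  · -- left inverse
    intro ν hν
    rw [Finset.mem_filter, Finset.mem_range] at hν
    have hmod := Nat.chineseRemainder_modEq_unique hco (Nat.mod_modEq ν q₁).symm
      (Nat.mod_modEq ν q₂).symm
    exact (Nat.ModEq.eq_of_lt_of_lt hmod hν.1
      (Nat.chineseRemainder_lt_mul hco _ _ hq₁.ne' hq₂.ne')).symm
  · -- right inverse
    rintro ⟨ν₁, ν₂⟩ hp
    rw [Finset.mem_product, Finset.mem_filter, Finset.mem_filter, Finset.mem_range,
      Finset.mem_range] at hp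
    obtain ⟨⟨hν₁, -⟩, ⟨hν₂, -⟩⟩ := hp
    set c := Nat.chineseRemainder hco ν₁ ν₂
    dsimp only at hν₁ hν₂
    have e₁ : (c : ℕ) % q₁ = ν₁ := Eq.trans c.2.1 (Nat.mod_eq_of_lt hν₁)
    have e₂ : (c : ℕ) % q₂ = ν₂ := Eq.trans c.2.2 (Nat.mod_eq_of_lt hν₂)
    exact Prod.ext e₁ e₂
  · -- the phases agree
    intro ν hν
    -- `ν ≡ q₂u₂(ν mod q₁) + q₁u₁(ν mod q₂)` modulo `q₁` and modulo `q₂`, hence modulo `q₁q₂`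
    have hm₁ : ν ≡ q₂ * u₂ * (ν % q₁) + q₁ * u₁ * (ν % q₂) [MOD q₁] := by
      have ha : q₂ * u₂ * (ν % q₁) ≡ 1 * ν [MOD q₁] := hu₂.mul (Nat.mod_modEq ν q₁)
      have hb : q₁ * u₁ * (ν % q₂) ≡ 0 [MOD q₁] :=
        Nat.modEq_zero_iff_dvd.mpr (by rw [mul_assoc]; exact dvd_mul_right _ _)
      have := (ha.add hb).symm
      rwa [one_mul, add_zero] at this
    have hm₂ : ν ≡ q₂ * u₂ * (ν % q₁) + q₁ * u₁ * (ν % q₂) [MOD q₂] := by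
      have ha : q₂ * u₂ * (ν % q₁) ≡ 0 [MOD q₂] :=
        Nat.modEq_zero_iff_dvd.mpr (by rw [mul_assoc]; exact dvd_mul_right _ _)
      have hb : q₁ * u₁ * (ν % q₂) ≡ 1 * ν [MOD q₂] := hu₁.mul (Nat.mod_modEq ν q₂)
      have := (ha.add hb).symm
      rwa [one_mul, zero_add] at this
    have hmod := (Nat.modEq_and_modEq_iff_modEq_mul hco).mp ⟨hm₁, hm₂⟩
    obtain ⟨k, hk⟩ := Nat.modEq_iff_dvd.mp hmod.symm
    simp only [Nat.cast_add, Nat.cast_mul] at hk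
    exact Weyl.exp_crt_split hq₁.ne' hq₂.ne' h k ν (ν % q₁) (ν % q₂) u₁ u₂
      (by linear_combination hk)

namespace Weyl

/-! ### The trivial bound -/

/-- `‖S(h,q)‖ ≤ #{ν mod q : ν² ≡ -1} = ρ(q)`: every term `e(hν/q)` has norm one. [folklore] -/
theorem norm_rootWeylSum_le_card (h : ℤ) (q : ℕ) :
    ‖∑ ν ∈ (Finset.range q).filter (fun ν : ℕ => q ∣ ν ^ 2 + 1),
        Complex.exp (2 * Real.pi * Complex.I * (h : ℂ) * (ν : ℂ) / (q : ℂ))‖ ≤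
      (((Finset.range q).filter (fun ν : ℕ => q ∣ ν ^ 2 + 1)).card : ℝ) := by
  refine (norm_sum_le _ _).trans (le_of_eq ?_)
  rw [Finset.card_eq_sum_ones, Nat.cast_sum, Nat.cast_one]
  refine Finset.sum_congr rfl fun ν _ => ?_
  rw [show 2 * (Real.pi : ℂ) * Complex.I * (h : ℂ) * (ν : ℂ) / (q : ℂ) =
      ((2 * Real.pi * h * ν / q : ℝ) : ℂ) * Complex.I by push_cast; ring]
  exact Complex.norm_exp_ofReal_mul_I _

/-- The same bound with the tree's `ρ` (`Iwaniec1978.rho`). [folklore] -/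
theorem norm_rootWeylSum_le_rho (h : ℤ) (q : ℕ) :
    ‖∑ ν ∈ (Finset.range q).filter (fun ν : ℕ => q ∣ ν ^ 2 + 1),
        Complex.exp (2 * Real.pi * Complex.I * (h : ℂ) * (ν : ℂ) / (q : ℂ))‖ ≤ (rho q : ℝ) :=
  norm_rootWeylSum_le_card h q

/-- `ρ(QQ') ≤ 4` for primes `Q, Q'` (also when `Q = Q'`: `ρ(Q²) ≤ 2`). [folklore] -/
theorem rho_mul_le_four_of_prime {Q Q' : ℕ} (hQ : Q.Prime) (hQ' : Q'.Prime) :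
    rho (Q * Q') ≤ 4 := by
  by_cases hQQ : Q = Q'
  · subst hQQ
    rw [← pow_two]
    exact (rho_primePow_le_two hQ one_le_two).trans (by norm_num)
  · rw [rho_mul_of_coprime hQ.ne_zero hQ'.ne_zero ((Nat.coprime_primes hQ hQ').mpr hQQ)]
    exact Nat.mul_le_mul (rho_le_two hQ) (rho_le_two hQ')

/-- `|(a|b)| ≤ 1` for the Jacobi symbol, as a complex norm. [folklore] -/
theorem norm_jacobiSym_cast_le_one (a : ℤ) (b : ℕ) : ‖(jacobiSym a b : ℂ)‖ ≤ 1 := by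
  rcases jacobiSym.trichotomy a b with h0 | h0 | h0 <;> simp [h0]

end Weyl

/-- **The trivial bound** for the twisted root Weyl sum over a box of primes `≡ 1 (mod 4)`
(the skeleton's `twistedSum h P₁ P₁' P₂ P₂'`, body expanded; registered sub-goal of
stmt-Parity-11583, support for `stub_weylShallow`):
`‖T_h‖ ≤ 4 · #{Q ∈ (P₁,P₁'] prime ≡ 1 (4)} · #{Q' ∈ (P₂,P₂'] prime ≡ 1 (4)}`,
via `|(Q|Q')| ≤ 1`, `‖S(h, QQ')‖ ≤ ρ(QQ') ≤ 4`. [folklore] -/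
theorem norm_twistedSum_le :
    ∀ (h : ℤ) (P₁ P₁' P₂ P₂' : ℕ),
      ‖∑ Q ∈ (Finset.Ioc P₁ P₁').filter (fun Q : ℕ => Q.Prime ∧ Q % 4 = 1),
          ∑ Q' ∈ (Finset.Ioc P₂ P₂').filter (fun Q' : ℕ => Q'.Prime ∧ Q' % 4 = 1),
            (jacobiSym (Q : ℤ) Q' : ℂ) *
              ∑ ν ∈ (Finset.range (Q * Q')).filter (fun ν : ℕ => Q * Q' ∣ ν ^ 2 + 1),
                Complex.exp (2 * Real.pi * Complex.I * (h : ℂ) * (ν : ℂ) / ((Q * Q' : ℕ) : ℂ))‖ ≤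
        4 * (((Finset.Ioc P₁ P₁').filter (fun Q : ℕ => Q.Prime ∧ Q % 4 = 1)).card : ℝ) *
          (((Finset.Ioc P₂ P₂').filter (fun Q' : ℕ => Q'.Prime ∧ Q' % 4 = 1)).card : ℝ) := by
  intro h P₁ P₁' P₂ P₂'
  set S₁ := (Finset.Ioc P₁ P₁').filter (fun Q : ℕ => Q.Prime ∧ Q % 4 = 1) with hS₁
  set S₂ := (Finset.Ioc P₂ P₂').filter (fun Q' : ℕ => Q'.Prime ∧ Q' % 4 = 1) with hS₂
  have hterm : ∀ Q ∈ S₁, ∀ Q' ∈ S₂,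
      ‖(jacobiSym (Q : ℤ) Q' : ℂ) *
          ∑ ν ∈ (Finset.range (Q * Q')).filter (fun ν : ℕ => Q * Q' ∣ ν ^ 2 + 1),
            Complex.exp (2 * Real.pi * Complex.I * (h : ℂ) * (ν : ℂ) / ((Q * Q' : ℕ) : ℂ))‖ ≤
        4 := by
    intro Q hQ Q' hQ'
    have hQp : Q.Prime := (Finset.mem_filter.mp hQ).2.1
    have hQ'p : Q'.Prime := (Finset.mem_filter.mp hQ').2.1
    rw [norm_mul]
    have hρ : (rho (Q * Q') : ℝ) ≤ 4 := by
      exact_mod_cast Weyl.rho_mul_le_four_of_prime hQp hQ'p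
    calc _ ≤ 1 * (rho (Q * Q') : ℝ) :=
          mul_le_mul (Weyl.norm_jacobiSym_cast_le_one _ _)
            (Weyl.norm_rootWeylSum_le_rho h (Q * Q')) (norm_nonneg _) zero_le_one
      _ ≤ 4 := by rw [one_mul]; exact hρ
  calc _ ≤ ∑ Q ∈ S₁, ‖∑ Q' ∈ S₂, (jacobiSym (Q : ℤ) Q' : ℂ) *
            ∑ ν ∈ (Finset.range (Q * Q')).filter (fun ν : ℕ => Q * Q' ∣ ν ^ 2 + 1),
              Complex.exp (2 * Real.pi * Complex.I * (h : ℂ) * (ν : ℂ) / ((Q * Q' : ℕ) : ℂ))‖ :=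
        norm_sum_le _ _
    _ ≤ ∑ Q ∈ S₁, ∑ Q' ∈ S₂, ‖(jacobiSym (Q : ℤ) Q' : ℂ) *
            ∑ ν ∈ (Finset.range (Q * Q')).filter (fun ν : ℕ => Q * Q' ∣ ν ^ 2 + 1),
              Complex.exp (2 * Real.pi * Complex.I * (h : ℂ) * (ν : ℂ) / ((Q * Q' : ℕ) : ℂ))‖ :=
        Finset.sum_le_sum fun Q _ => norm_sum_le _ _
    _ ≤ ∑ Q ∈ S₁, ∑ Q' ∈ S₂, (4 : ℝ) :=
        Finset.sum_le_sum fun Q hQ => Finset.sum_le_sum fun Q' hQ' => hterm Q hQ Q' hQ'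
    _ = 4 * (S₁.card : ℝ) * (S₂.card : ℝ) := by
        simp only [Finset.sum_const, nsmul_eq_mul]
        ring

namespace Weyl

/-! ### Prime moduli: the root Weyl sum is a cosine -/

/-- For an odd prime `Q` and a root `r` of `r² ≡ -1 (mod Q)`, the roots modulo `Q` are exactly
`r` and `Q - r`, and they are distinct. [folklore] -/
theorem filter_roots_eq_pair_of_prime {Q r : ℕ} (hQ : Q.Prime) (hQ2 : Q ≠ 2) (hr : r < Q)
    (hQr : Q ∣ r ^ 2 + 1) :
    r ≠ Q - r ∧ (Finset.range Q).filter (fun ν : ℕ => Q ∣ ν ^ 2 + 1) = {r, Q - r} := by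
  have hr0 : r ≠ 0 := by
    rintro rfl
    exact hQ.one_lt.ne' (Nat.dvd_one.mp (by simpa using hQr))
  have hne : r ≠ Q - r := by
    intro h
    have h2r : Q = 2 * r := by omega
    have : 2 ∣ Q := ⟨r, h2r⟩
    exact hQ2 ((Nat.prime_dvd_prime_iff_eq Nat.prime_two hQ).mp this).symm
  refine ⟨hne, ?_⟩
  symm
  apply Finset.eq_of_subset_of_card_le
  · intro ν hν
    rw [Finset.mem_insert, Finset.mem_singleton] at hν
    rw [Finset.mem_filter, Finset.mem_range]
    rcases hν with rfl | rfl
    · exact ⟨hr, hQr⟩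
    · refine ⟨Nat.sub_lt hQ.pos (Nat.pos_of_ne_zero hr0), ?_⟩
      have hle : r ≤ Q := hr.le
      have key : (Q - r) ^ 2 + 1 + Q * (2 * r) = (r ^ 2 + 1) + Q * Q := by
        zify [hle]
        ring
      have h1 : Q ∣ (Q - r) ^ 2 + 1 + Q * (2 * r) := by
        rw [key]; exact dvd_add hQr (dvd_mul_right Q Q)
      exact (Nat.dvd_add_left (dvd_mul_right Q (2 * r))).mp h1
  · rw [Finset.card_pair hne]
    exact rho_le_two hQ

/-- A prime `Q ≡ 1 (mod 4)` has a root `r` of `r² ≡ -1 (mod Q)` (`-1` is a square mod `Q`).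
[folklore] -/
theorem exists_root_of_prime_mod_four_eq_one {Q : ℕ} (hQ : Q.Prime) (hQ4 : Q % 4 = 1) :
    ∃ r : ℕ, r < Q ∧ Q ∣ r ^ 2 + 1 := by
  haveI := Fact.mk hQ
  obtain ⟨y, hy⟩ := (ZMod.exists_sq_eq_neg_one_iff (p := Q)).mpr (by omega)
  refine ⟨y.val, ZMod.val_lt y, (ZMod.natCast_eq_zero_iff _ _).mp ?_⟩
  push_cast
  rw [ZMod.natCast_zmod_val, sq, ← hy]
  ring

/-- For a prime `Q ≡ 1 (mod 4)`, `ρ(Q) = #{ν mod Q : ν² ≡ -1} = 2`. [folklore] -/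
theorem card_roots_eq_two_of_prime_mod_four_eq_one {Q : ℕ} (hQ : Q.Prime) (hQ4 : Q % 4 = 1) :
    ((Finset.range Q).filter (fun ν : ℕ => Q ∣ ν ^ 2 + 1)).card = 2 := by
  obtain ⟨r, hr, hQr⟩ := exists_root_of_prime_mod_four_eq_one hQ hQ4
  obtain ⟨hne, hset⟩ := filter_roots_eq_pair_of_prime hQ (by omega) hr hQr
  rw [hset, Finset.card_pair hne]

/-- **The root Weyl sum to an odd prime modulus is a cosine**: for an odd prime `Q` with a root
`r` of `r² ≡ -1 (mod Q)`, `S(a, Q) = e(ar/Q) + e(-ar/Q) = 2 cos(2π a r / Q)`; with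
`rootWeylSum_mul_of_coprime` this exhibits `S(h, QQ') = 4 cos(2π h Q̄' r/Q) cos(2π h Q̄ r'/Q')`
for distinct primes `Q, Q' ≡ 1 (mod 4)`. [folklore] -/
theorem rootWeylSum_prime_eq_two_mul_cos (a : ℤ) {Q r : ℕ} (hQ : Q.Prime) (hQ2 : Q ≠ 2)
    (hr : r < Q) (hQr : Q ∣ r ^ 2 + 1) :
    ∑ ν ∈ (Finset.range Q).filter (fun ν : ℕ => Q ∣ ν ^ 2 + 1),
        Complex.exp (2 * Real.pi * Complex.I * (a : ℂ) * (ν : ℂ) / (Q : ℂ)) =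
      ((2 * Real.cos (2 * Real.pi * a * r / Q) : ℝ) : ℂ) := by
  obtain ⟨hne, hset⟩ := filter_roots_eq_pair_of_prime hQ hQ2 hr hQr
  rw [hset, Finset.sum_pair hne, Nat.cast_sub hr.le]
  have hQ0 : (Q : ℂ) ≠ 0 := by exact_mod_cast hQ.ne_zero
  push_cast
  rw [Complex.two_cos]
  congr 1
  · congr 1
    ring
  · refine Complex.exp_eq_exp_iff_exists_int.mpr ⟨a, ?_⟩
    field_simp
    ring

/-- **The root Weyl sum to a modulus `QQ'` with distinct odd primes** (CRT × cosine, the explicit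
"Kloosterman point"): with roots `r (mod Q)`, `r' (mod Q')` of `-1` and inverses
`Q'u₂ ≡ 1 (mod Q)`, `Qu₁ ≡ 1 (mod Q')`,
`S(h, QQ') = 2cos(2π h u₂ r / Q) · 2cos(2π h u₁ r' / Q')`. [folklore] -/
theorem rootWeylSum_prime_mul_prime (h : ℤ) {Q Q' r r' u₁ u₂ : ℕ} (hQ : Q.Prime)
    (hQ' : Q'.Prime) (hQ2 : Q ≠ 2) (hQ'2 : Q' ≠ 2) (hne : Q ≠ Q') (hr : r < Q)
    (hQr : Q ∣ r ^ 2 + 1) (hr' : r' < Q') (hQr' : Q' ∣ r' ^ 2 + 1) (hu₂ : Q' * u₂ ≡ 1 [MOD Q])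
    (hu₁ : Q * u₁ ≡ 1 [MOD Q']) :
    ∑ ν ∈ (Finset.range (Q * Q')).filter (fun ν : ℕ => Q * Q' ∣ ν ^ 2 + 1),
        Complex.exp (2 * Real.pi * Complex.I * (h : ℂ) * (ν : ℂ) / ((Q * Q' : ℕ) : ℂ)) =
      ((2 * Real.cos (2 * Real.pi * (h * u₂ : ℤ) * r / Q) : ℝ) : ℂ) *
        ((2 * Real.cos (2 * Real.pi * (h * u₁ : ℤ) * r' / Q') : ℝ) : ℂ) := by
  rw [rootWeylSum_mul_of_coprime h ((Nat.coprime_primes hQ hQ').mpr hne) hu₂ hu₁,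
    rootWeylSum_prime_eq_two_mul_cos (h * u₂) hQ hQ2 hr hQr,
    rootWeylSum_prime_eq_two_mul_cos (h * u₁) hQ' hQ'2 hr' hQr']

/-! ### Bridge to the tree's `polyRootWeylSum` -/

open Polynomial in
/-- `S(h, q)` is the tree's Weyl sum over the roots of `X² + 1` modulo `q`:
`rootWeylSum h q = polyRootWeylSum (X² + 1) q h` (so Hooley's and the Duke–Friedlander–Iwaniec /
Tóth estimates of `Literature.NumberTheory.Sieve` apply to it verbatim). [folklore] -/
theorem rootWeylSum_eq_polyRootWeylSum (h : ℤ) (q : ℕ) :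
    ∑ ν ∈ (Finset.range q).filter (fun ν : ℕ => q ∣ ν ^ 2 + 1),
        Complex.exp (2 * Real.pi * Complex.I * (h : ℂ) * (ν : ℂ) / (q : ℂ)) =
      Literature.NumberTheory.Sieve.polyRootWeylSum (X ^ 2 + 1) q h := by
  rw [Literature.NumberTheory.Sieve.polyRootWeylSum_def]
  refine Finset.sum_congr ?_ fun ν _ => ?_
  · refine Finset.filter_congr fun ν _ => ?_
    simp only [eval_add, eval_pow, eval_X, eval_one]
    exact_mod_cast Iff.rfl
  · congr 1
    ring

end Weyl

end Summit.Parity.BatemanHorn.Cruxes.SplitBlockJacobi.CofactorRootDiscrepancy
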